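import Mathlib
import Summits.NavierStokesRegularity.NavierStokesRegularity.Theorems.SymmetryModuliCountLinearLiouvilleSevenHarmonicLinearGrowth
import Summits.NavierStokesRegularity.NavierStokesRegularity.Theorems.SymmetryModuliCountLinearLiouvilleSevenAnchorPressure
import Summits.NavierStokesRegularity.NavierStokesRegularity.Theorems.SymmetryModuliCountLinearLiouvilleSevenAnchorIncrements
import HarnessLib

/-!
# Anchor of crux `LinearLiouvilleSeven` (route `SymmetryModuliCount`): the assembly (stub A3)

Item stmt-NavierStokesRegularity-4054 (`LinearLiouvilleSeven`, route `SymmetryModuliCount`), line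
`galilean-collapse` (`Cruxes/LinearLiouvilleSeven/Lines/galilean-collapse.lean`), registered stub A3
`stub_anchorAssembly`, proved verbatim: the `u = 0` ANCHOR of the crux — every tempered classical
ancient solution `(v, q)` of the Stokes system `∂ₜv = Δv − ∇q`, `div v = 0` on `(−∞, 0) × ℝ³`
(`‖v‖ ≤ K/√(−t) + K(1+‖x‖)/(−t)`, `|q| ≤ K/(−t) + K(1+‖x‖)/√(−t)³`) is spatially constant on
every slice — from the landed inputs A1 `stub_harmonicLinearGrowthGradient` (p72234), A2
`stub_caloricSliceLipschitz` (p72133), A3a `stub_anchorPressure` (p72245), the (S1) increment bound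
`anchorAsm_increment_bound` (sibling file `…AnchorIncrements`), and the gradient-is-caloric input C1
(first hypothesis of the stub, verbatim `AnchorGradientCaloric`, itself landed as
`stub_anchorGradientCaloric`, p74208).

## Proof ("translation differences"; no heat kernel, no time antiderivative)

(P) `∇q(t, ·) = γ(t)` is slice-constant (A3a from A1). (S1) the increments of the entries
`w = ⟪Dv a, e⟫` are bounded, `|w(t, h + x) − w(t, x)| ≤ 44K‖a‖‖e‖/(−t)`. (S2) Each `w` is an ancient
caloric function (C1), so `d_h = w(·, h + ·) − w` is a BOUNDED ancient caloric function on `s ≤ t`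
and A2 with slope `0` makes `d_h(t, ·)` constant. (S3) A function with constant bounded increments
is constant (`anchorAsm_const_of_increments`): `Dv(t, ·) ≡ M(t)`, `v(t, ·)` is affine, and the
growth bound gives `‖M(t) a‖ ≤ K‖a‖/(−t)` (`anchorAsm_fderiv_zero_bound`). (S4) `⟪M(·) a, e⟫` has
time derivative `Δ` of a constant slice `= 0`, so it is constant on `(−∞, 0)` and equals its limit
`0` at `−∞` (`anchorAsm_fderiv_zero_eq_zero`); hence `Dv ≡ 0` and every slice of `v` is constant.

With this file the anchor `AtZero` of `Theorems/LinearLiouvilleSeven/Negative/NormalForm.lean` is a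
theorem, and `TypeIAncientLiouville → LinearLiouvilleSeven` holds unconditionally (companion file
`SymmetryModuliCountLinearLiouvilleSevenOfTarget.lean`).

## References

* G. Koch, N. Nadirashvili, G. Seregin, V. Šverák, Acta Math. 203 (2009), §1 (parasitic solutions,
  the gauge), Prop. 4.1 [KNSS2009].
* G. M. Lieberman, *Second order parabolic differential equations*, 1996, Ch. II [Lieberman1996].
-/

noncomputable section

set_option linter.dupNamespace false -- tree namespace `Summit.<S>.<S>.Theorems` (summit = sub-problem) trips the core linter under standalone elaboration; the lakefile sets it weakly

open Set Function Filter InnerProductSpace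
open scoped Laplacian ContDiff Topology RealInnerProductSpace

namespace Summit.NavierStokesRegularity.NavierStokesRegularity.Theorems

open Literature.Analysis.FluidPDE

/-! ### Steps (S2)–(S3): the velocity gradient is slice-constant -/

/-- **(S2)–(S3)** For a tempered ancient Stokes pair with slice-constant pressure gradient whose
velocity-gradient entries `w = ⟪Dv a, e⟫` are ancient caloric functions (input C1), the velocity
gradient is constant on every slice: `Dv(t, x) a = Dv(t, 0) a`. Proof: by (S1) the increment
`d_h = w(·, h + ·) − w` is a BOUNDED ancient caloric function on `s ≤ t`, hence slice-constant by
A2 with slope `0`; so `w(t, ·)` has constant bounded increments and is constant. -/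
theorem anchorAsm_fderiv_slice_const
    {v : ℝ → EuclideanSpace ℝ (Fin 3) → EuclideanSpace ℝ (Fin 3)}
    {q : ℝ → EuclideanSpace ℝ (Fin 3) → ℝ} {K : ℝ}
    (hv : IsSmoothSpaceTimeOn (Iio 0) v)
    (hK : ∀ t < 0, ∀ x, ‖v t x‖ ≤ K / Real.sqrt (-t) + K * (1 + ‖x‖) / (-t))
    (heq : ∀ t < 0, ∀ x, timeDeriv v t x = (Δ (v t)) x - gradient (q t) x)
    (hP : ∀ t < 0, ∀ x, gradient (q t) x = gradient (q t) 0)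
    (hC1 : ∀ a b : EuclideanSpace ℝ (Fin 3),
      IsSmoothSpaceTimeOn (Iio 0) (fun t x => ⟪fderiv ℝ (v t) x a, b⟫) ∧
      ∀ t < 0, ∀ x, timeDeriv (fun t x => ⟪fderiv ℝ (v t) x a, b⟫) t x =
        (Δ (fun x => ⟪fderiv ℝ (v t) x a, b⟫)) x)
    {t : ℝ} (ht : t < 0) (x a : EuclideanSpace ℝ (Fin 3)) :
    fderiv ℝ (v t) x a = fderiv ℝ (v t) 0 a := by
  have hK0 : 0 ≤ K := anchorAsm_K_nonneg hK
  have hnt : 0 < -t := by linarith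
  refine ext_inner_right ℝ fun e => ?_
  -- the caloric entry `w = ⟪Dv a, e⟫`
  obtain ⟨hw, hwcal⟩ := hC1 a e
  set w : ℝ → EuclideanSpace ℝ (Fin 3) → ℝ := fun s y => ⟪fderiv ℝ (v s) y a, e⟫ with hwdef
  have heqw : ∀ s < 0, ∀ y, timeDeriv w s y = (Δ (w s)) y + (fun _ : ℝ => (0 : ℝ)) s := by
    intro s hs y
    rw [add_zero]
    exact hwcal s hs y
  -- constant increments of the slice `w t`
  have hinc : ∀ y h, w t (h + y) - w t y = w t h - w t 0 := by
    intro y h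
    obtain ⟨hd, hdcal⟩ := anchorAsm_increment_caloric hw heqw h
    set d : ℝ → EuclideanSpace ℝ (Fin 3) → ℝ := fun s z => w s (h + z) - w s z with hddef
    set A : ℝ := 44 * K / (-t) * ‖e‖ * ‖a‖ with hAdef
    have hA : 0 ≤ A := by positivity
    have hbd : ∀ s ≤ t, ∀ z, |d s z| ≤ A + 0 * ‖z‖ := by
      intro s hs z
      have hs0 : s < 0 := lt_of_le_of_lt hs ht
      have hns : 0 < -s := by linarith
      rw [zero_mul, add_zero]
      calc |d s z| = |⟪fderiv ℝ (v s) (h + z) a - fderiv ℝ (v s) z a, e⟫| := by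
            simp only [hddef, hwdef, inner_sub_left]
        _ ≤ 44 * K / (-s) * ‖e‖ * ‖a‖ := anchorAsm_increment_bound hv hK heq hP hs0 z h a e
        _ ≤ A := by
            simp only [hAdef]
            have : 44 * K / (-s) ≤ 44 * K / (-t) :=
              div_le_div_of_nonneg_left (by positivity) hnt (by linarith)
            gcongr
    have h0 := stub_caloricSliceLipschitz d t A 0 ht hd hdcal hA le_rfl hbd 0 y
    simp only [mul_zero, zero_mul] at h0
    have h1 : d t y = d t 0 := by
      have := abs_nonpos_iff.1 h0
      linarith
    simpa only [hddef, add_zero] using h1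
  -- bounded increments of the slice `w t`
  have hbdinc : ∀ h, |w t h - w t 0| ≤ 44 * K / (-t) * ‖e‖ * ‖a‖ := by
    intro h
    have := anchorAsm_increment_bound hv hK heq hP ht 0 h a e
    simpa only [hwdef, add_zero, inner_sub_left] using this
  exact anchorAsm_const_of_increments hinc hbdinc x

/-! ### Step (S3'): the slice-constant gradient obeys the scale-natural bound -/

/-- **(S3')** If the slice `v(t, ·)` has constant derivative `M = Dv(t, 0)` and obeys the
tempered bound, then `‖M a‖ ≤ K‖a‖/(−t)`: `v(t, ·)` is affine, `M y = v(t, y) − v(t, 0)`, and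
`R ‖M a‖ = ‖M (R a)‖ ≤ 2K/√(−t) + K(2 + R‖a‖)/(−t)` for every `R > 0`. -/
theorem anchorAsm_fderiv_zero_bound
    {v : ℝ → EuclideanSpace ℝ (Fin 3) → EuclideanSpace ℝ (Fin 3)} {K t : ℝ}
    (hvt : Differentiable ℝ (v t)) (hK0 : 0 ≤ K) (ht : t < 0)
    (hKt : ∀ x, ‖v t x‖ ≤ K / Real.sqrt (-t) + K * (1 + ‖x‖) / (-t))
    (hconst : ∀ x, fderiv ℝ (v t) x = fderiv ℝ (v t) 0) (a : EuclideanSpace ℝ (Fin 3)) :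
    ‖fderiv ℝ (v t) 0 a‖ ≤ K / (-t) * ‖a‖ := by
  have hnt : 0 < -t := by linarith
  set M := fderiv ℝ (v t) 0 with hM
  -- `v t` is affine: `M y = v t y - v t 0`
  have haff : ∀ y, M y = v t y - v t 0 := by
    intro y
    have hφ : Differentiable ℝ (fun z => v t z - M z) := hvt.sub M.differentiable
    have hφ' : ∀ z, fderiv ℝ (fun z => v t z - M z) z = 0 := by
      intro z
      rw [fderiv_fun_sub (hvt z) (M.differentiableAt), ContinuousLinearMap.fderiv, hconst z,
        sub_self]
    have := is_const_of_fderiv_eq_zero hφ hφ' y 0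
    simp only [map_zero, sub_zero] at this
    rw [← this]
    abel
  have hMy : ∀ y, ‖M y‖ ≤ (2 * K / Real.sqrt (-t) + 2 * K / (-t)) + K / (-t) * ‖y‖ := by
    intro y
    rw [haff y]
    calc ‖v t y - v t 0‖ ≤ ‖v t y‖ + ‖v t 0‖ := norm_sub_le _ _
      _ ≤ (K / Real.sqrt (-t) + K * (1 + ‖y‖) / (-t)) + (K / Real.sqrt (-t) + K * (1 + ‖(0 :
          EuclideanSpace ℝ (Fin 3))‖) / (-t)) := add_le_add (hKt y) (hKt 0)
      _ = (2 * K / Real.sqrt (-t) + 2 * K / (-t)) + K / (-t) * ‖y‖ := by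
          rw [norm_zero]
          field_simp
          ring
  refine le_of_forall_pos_mul_le_add_mul (K := 2 * K / Real.sqrt (-t) + 2 * K / (-t))
    (by positivity) fun R hR => ?_
  have h1 := hMy (R • a)
  rw [map_smul, norm_smul, Real.norm_eq_abs, abs_of_pos hR, norm_smul, Real.norm_eq_abs,
    abs_of_pos hR] at h1
  calc R * ‖M a‖ ≤ (2 * K / Real.sqrt (-t) + 2 * K / (-t)) + K / (-t) * (R * ‖a‖) := h1
    _ = (2 * K / Real.sqrt (-t) + 2 * K / (-t)) + K / (-t) * ‖a‖ * R := by ring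

/-! ### Step (S4): the slice-constant gradient is constant in time and vanishes -/

/-- **(S4)** If every slice gradient is constant, `Dv(s, y) = Dv(s, 0) =: M(s)`, with
`‖M(s) a‖ ≤ K‖a‖/(−s)`, and the entries `⟪Dv a, e⟫` are ancient caloric (C1), then `M ≡ 0`:
the entry `s ↦ ⟪M(s) a, e⟫` has zero time derivative (`= Δ` of a constant slice), so it is
constant on `(−∞, 0)` and equals its limit `0` at `s → −∞`. -/
theorem anchorAsm_fderiv_zero_eq_zero
    {v : ℝ → EuclideanSpace ℝ (Fin 3) → EuclideanSpace ℝ (Fin 3)} {K : ℝ}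
    (hslice : ∀ s < 0, ∀ y a, fderiv ℝ (v s) y a = fderiv ℝ (v s) 0 a)
    (hbound : ∀ s < 0, ∀ a, ‖fderiv ℝ (v s) 0 a‖ ≤ K / (-s) * ‖a‖)
    (hC1 : ∀ a b : EuclideanSpace ℝ (Fin 3),
      IsSmoothSpaceTimeOn (Iio 0) (fun t x => ⟪fderiv ℝ (v t) x a, b⟫) ∧
      ∀ t < 0, ∀ x, timeDeriv (fun t x => ⟪fderiv ℝ (v t) x a, b⟫) t x =
        (Δ (fun x => ⟪fderiv ℝ (v t) x a, b⟫)) x)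
    {t : ℝ} (ht : t < 0) (a e : EuclideanSpace ℝ (Fin 3)) : ⟪fderiv ℝ (v t) 0 a, e⟫ = 0 := by
  obtain ⟨hw, hwcal⟩ := hC1 a e
  set f : ℝ → ℝ := fun s => ⟪fderiv ℝ (v s) 0 a, e⟫ with hfdef
  -- `f` is differentiable on `(−∞, 0)` with zero derivative
  have hdiff : DifferentiableOn ℝ f (Iio 0) := fun s hs =>
    ((hw.differentiableWithinAt_time hs 0).differentiableAt (Iio_mem_nhds hs)).differentiableWithinAt
  have hderiv : (Iio 0).EqOn (deriv f) 0 := by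
    intro s hs
    have hs' : s < 0 := hs
    have h1 := hwcal s hs' 0
    rw [timeDeriv_apply] at h1
    have hconst : (fun x => ⟪fderiv ℝ (v s) x a, e⟫) = fun _ => f s := by
      funext y
      simp only [hfdef, hslice s hs' y a]
    rw [hconst, laplacian_const] at h1
    exact h1
  have hfc : ∀ s < 0, f s = f t := fun s hs =>
    isOpen_Iio.is_const_of_deriv_eq_zero isPreconnected_Iio hdiff hderiv hs ht
  -- the bound `|f s| ≤ K‖a‖‖e‖/(−s)` forces the constant to vanish
  have hfb : ∀ s < 0, |f s| ≤ K / (-s) * ‖a‖ * ‖e‖ := fun s hs =>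
    (abs_real_inner_le_norm _ _).trans (mul_le_mul_of_nonneg_right (hbound s hs a) (norm_nonneg _))
  by_contra hne
  have hpos : 0 < |f t| := abs_pos.2 hne
  have hKae : 0 ≤ K * ‖a‖ * ‖e‖ := by
    have h1 := hfb t ht
    have h2 : K / (-t) * ‖a‖ * ‖e‖ = (K * ‖a‖ * ‖e‖) / (-t) := by ring
    rw [h2] at h1
    have hnt : 0 < -t := by linarith
    have := hpos.trans_le h1
    exact (div_pos_iff_of_pos_right hnt).1 this |>.le
  set s : ℝ := -(K * ‖a‖ * ‖e‖ / |f t| + 1) with hsdef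
  have hs : s < 0 := by
    rw [hsdef]
    have : 0 ≤ K * ‖a‖ * ‖e‖ / |f t| := by positivity
    linarith
  have h1 := hfb s hs
  rw [hfc s hs] at h1
  have hns : -s = K * ‖a‖ * ‖e‖ / |f t| + 1 := by rw [hsdef]; ring
  have h2 : K / (-s) * ‖a‖ * ‖e‖ < |f t| := by
    rw [show K / (-s) * ‖a‖ * ‖e‖ = (K * ‖a‖ * ‖e‖) / (-s) by ring, hns,
      div_lt_iff₀ (by positivity)]
    calc K * ‖a‖ * ‖e‖ = |f t| * (K * ‖a‖ * ‖e‖ / |f t|) := by field_simp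
      _ < |f t| * (K * ‖a‖ * ‖e‖ / |f t| + 1) := by
          apply mul_lt_mul_of_pos_left _ hpos
          linarith
  linarith

/-! ### The registered stub A3: the anchor assembly -/

/-- **Registered stub A3 (`stub_anchorAssembly`) of crux stmt-NavierStokesRegularity-4054, line
`galilean-collapse`: the `u = 0` ANCHOR of `LinearLiouvilleSeven`.** Given the gradient-is-caloric
input C1 (first hypothesis, verbatim `AnchorGradientCaloric`, discharged by
`Theorems.stub_anchorGradientCaloric`), every tempered classical ancient solution `(v, q)` of the
Stokes system `∂ₜv = Δv − ∇q`, `div v = 0` on `(−∞, 0) × ℝ³` — jointly smooth,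
`‖v‖ ≤ K/√(−t) + K(1+‖x‖)/(−t)`, `|q| ≤ K/(−t) + K(1+‖x‖)/√(−t)³` — is spatially constant on
every slice. Proof ("translation differences"): (P) `∇q(t, ·)` is slice-constant
(`stub_anchorPressure` with `stub_harmonicLinearGrowthGradient`); (S1) the increments of the
gradient entries `w = ⟪Dv a, e⟫` are bounded by `44K‖a‖‖e‖/(−t)` (caloric translation
differences of `⟪v, e⟫` + the slice-Lipschitz estimate `stub_caloricSliceLipschitz`); (S2)–(S3)
the bounded caloric increments are slice-constant, hence `w(t, ·)` has constant bounded
increments and is constant: `Dv(t, ·) ≡ M(t)` with `‖M(t)‖ ≤ K/(−t)`; (S4) `s ↦ ⟪M(s) a, e⟫` is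
caloric with constant slices, hence constant in time, and tends to `0` as `s → −∞`: `M ≡ 0`, so
`v(t, ·)` is constant. -/
theorem stub_anchorAssembly :
    (∀ (v : ℝ → EuclideanSpace ℝ (Fin 3) → EuclideanSpace ℝ (Fin 3))
      (q : ℝ → EuclideanSpace ℝ (Fin 3) → ℝ),
      ContDiffOn ℝ (⊤ : ℕ∞) (Function.uncurry v) (Set.Iio 0 ×ˢ Set.univ) →
      ContDiffOn ℝ (⊤ : ℕ∞) (Function.uncurry q) (Set.Iio 0 ×ˢ Set.univ) →
      (∀ t < 0, ∀ x, Literature.Analysis.FluidPDE.timeDeriv v t x =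
        Laplacian.laplacian (v t) x - gradient (q t) x) →
      (∀ t < 0, ∀ x, gradient (q t) x = gradient (q t) 0) →
      ∀ a b : EuclideanSpace ℝ (Fin 3),
        ContDiffOn ℝ (⊤ : ℕ∞)
          (Function.uncurry fun t x => inner ℝ (fderiv ℝ (v t) x a) b) (Set.Iio 0 ×ˢ Set.univ) ∧
        ∀ t < 0, ∀ x,
          Literature.Analysis.FluidPDE.timeDeriv (fun t x => inner ℝ (fderiv ℝ (v t) x a) b) t x =
            Laplacian.laplacian (fun x => inner ℝ (fderiv ℝ (v t) x a) b) x) →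
    ∀ (v : ℝ → EuclideanSpace ℝ (Fin 3) → EuclideanSpace ℝ (Fin 3)) (q : ℝ → EuclideanSpace ℝ (Fin 3)
    → ℝ), ContDiffOn ℝ (⊤ : ℕ∞) (Function.uncurry v) (Set.Iio 0 ×ˢ Set.univ) → ContDiffOn ℝ (⊤ : ℕ∞)
    (Function.uncurry q) (Set.Iio 0 ×ˢ Set.univ) → (∃ K : ℝ, ∀ t < 0, ∀ x, ‖v t x‖ ≤ K / Real.sqrt
    (-t) + K * (1 + ‖x‖) / (-t) ∧ |q t x| ≤ K / (-t) + K * (1 + ‖x‖) / Real.sqrt (-t) ^ 3) → (∀ t <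
    0, Literature.Analysis.FluidPDE.VectorCalculus.IsDivFree (v t)) → (∀ t < 0, ∀ x,
    Literature.Analysis.FluidPDE.timeDeriv v t x = Laplacian.laplacian (v t) x - gradient (q t) x) →
    ∀ t < 0, ∃ b : EuclideanSpace ℝ (Fin 3), ∀ x, v t x = b := by
  intro hC1 v q hv hq hKq hdiv heq t ht
  obtain ⟨K, hK⟩ := hKq
  have hvS : IsSmoothSpaceTimeOn (Iio 0) v := hv
  have hK0 : 0 ≤ K := anchorAsm_K_nonneg fun s hs x => (hK s hs x).1
  have hKv : ∀ s < 0, ∀ x, ‖v s x‖ ≤ K / Real.sqrt (-s) + K * (1 + ‖x‖) / (-s) :=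
    fun s hs x => (hK s hs x).1
  -- (P) the pressure gradient is slice-constant
  obtain ⟨C, hC⟩ := stub_anchorPressure stub_harmonicLinearGrowthGradient v q hv hq ⟨K, hK⟩ hdiv heq
  have hP : ∀ s < 0, ∀ x, gradient (q s) x = gradient (q s) 0 := fun s hs x => (hC s hs).1 x
  -- (C1) the gradient entries are ancient caloric functions
  have hC1' := hC1 v q hv hq heq hP
  -- (S2)–(S3) the gradient is slice-constant
  have hslice : ∀ s < 0, ∀ y a, fderiv ℝ (v s) y a = fderiv ℝ (v s) 0 a := fun s hs y a =>
    anchorAsm_fderiv_slice_const hvS hKv heq hP hC1' hs y a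
  -- (S3') and it obeys the scale-natural bound
  have hbound : ∀ s < 0, ∀ a, ‖fderiv ℝ (v s) 0 a‖ ≤ K / (-s) * ‖a‖ := by
    intro s hs a
    have hvs : Differentiable ℝ (v s) := (hvS.contDiff_slice hs).differentiable (by simp)
    exact anchorAsm_fderiv_zero_bound hvs hK0 hs (hKv s hs)
      (fun y => ContinuousLinearMap.ext fun a' => hslice s hs y a') a
  -- (S4) hence it vanishes
  have hzero' : ∀ a, fderiv ℝ (v t) 0 a = 0 := fun a =>
    ext_inner_right ℝ fun e => by
      rw [inner_zero_left]
      exact anchorAsm_fderiv_zero_eq_zero hslice hbound hC1' ht a e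
  have hzero : ∀ y, fderiv ℝ (v t) y = 0 := fun y =>
    ContinuousLinearMap.ext fun a => by rw [hslice t ht y a, hzero' a, zero_apply]
  -- so the slice is constant
  have hvt : Differentiable ℝ (v t) := (hvS.contDiff_slice ht).differentiable (by simp)
  exact ⟨v t 0, fun x => is_const_of_fderiv_eq_zero hvt hzero x 0⟩

end Summit.NavierStokesRegularity.NavierStokesRegularity.Theorems

end
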